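import Literature.MathematicalPhysics.QuantumFieldTheory.BalabanImbrieJaffe1984to88.BIJ88Eq242HiggsCovariancePrintNorm
import Literature.MathematicalPhysics.QuantumFieldTheory.BalabanImbrieJaffe1984to88.BIJ88NeumannPropagatorActualBackground

/-!
# `BalabanImbrieJaffe1984to88.BIJ88Eq242HiggsCovariancePrintNormActualBackground` — T. Bałaban, J. Imbrie, A. Jaffe, *Effective action and
cluster properties of the abelian Higgs model*, Commun. Math. Phys. **114** (1988) 257–315 [BalabanImbrieJaffe1988], §2 pp. 264–265 [PDF 8–9],
(2.40)–(2.47), with [BalabanImbrieJaffe1985] = [I], §7.3 p. 326 [PDF 28] (7.3.1):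
**[6] (5.6) WITH `k`-UNIFORM CONSTANTS + (2.40)-INVERTIBILITY, (2.42), (2.45), (2.41) (walk route), (2.46), (2.47) FOR THE PRINT-NORMALIZED
`C^{(k)}_Λ(u_k) = [(Δ^{print}_{k,loc}(u_k) + κ′P(u_k′))|_Λ]^{−1}` AT THE ACTUAL BACKGROUND `u_k = actualBgU1 hd2 k e v` OF [I] (4.5.4) UNDER THE
PRINTED (7.3.1) `‖v(∂q) − 1‖ ≤ e𝓅(e)`, ONE THRESHOLD `e𝓅(e) ≤ c₁ = 1/(23D²K)`** — each member is gen 23's print-normalized torus-data theorem of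
`BIJ88Eq242HiggsCovariancePrintNorm` (`hyp56_printNorm_smallPlaquette_torus_cwt`, `eq242_printNorm_…`, `eq245_printNorm_…`,
`decay241_walk_printNorm_…`, `ineq246_printNorm_…`, `close247_printNorm_smallPlaquette_torus_cwt`) with its background data `(u, θ, 0 ≤ θ,
‖u(∂p) − 1‖ ≤ θ, (L^{2k}θ)² ≤ 1/500)` SUPPLIED by p34 gen 19's passage `BIJ88NeumannPropagatorActualBackground.smallPlaquette_actualBg` at
`θ = K·e𝓅(e)/(L^k)²` — the pattern of gen 23's `BIJ88Eq242HiggsCovarianceActualBackground` at the `k`-UNIFORM constants `(γ_P, c_P, δ₀)`.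
Nothing is re-derived.

statement-level skeleton of published theorems with citation tags; proofs where landed; nothing here is a claim about the Yang–Mills mass gap

Print [I] p. 326: *"The propagators arising from Δ_k(u_k), under the restriction (7.3.1) on the gauge field, also satisfy the regularity and
decay estimates of [7]."*; [BIJ88] p. 264: *"C^{(k)}_Λ(u) = Σ_ω C^{(k)}_{Λ,ω}(u), (2.42) where ω is a walk on a lattice of spacing M = O(1)."*

CONTENTS: **`hyp56_printNorm_actualBg`**, **`eq242_printNorm_actualBg`**, **`eq245_printNorm_actualBg`**, **`decay241_walk_printNorm_actualBg`**,
**`ineq246_printNorm_actualBg`**, **`close247_printNorm_actualBg`** (binder list = gen 23's `BIJ88Eq242HiggsCovarianceActualBackground` verbatim;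
constants `(c₁, δ₀, c₀, K)` before the instance; `θ = K·e𝓅(e)/(L^k)²` inside `γ_P = gammaP P a k θ …` and the largeness condition).

HONEST SCOPE / DIVERGENCE.  Exactly gen 23's `BIJ88Eq242HiggsCovariancePrintNorm` scope (print-normalized operator `(a_k/A)·deltaLocT`, `k`-uniform
`(γ_P, c_P)`; realified coordinates + complex forms; p13's walk data; `Ω = T_η`; half-torus reference box) at the particular background
`u = u_k(e, v)`; the smallness `(T₁, δ′, σ)` of `lineIter u_k k` and the largeness condition stay DISPLAYED hypotheses; (7.3.1) on all
plaquettes of `v` (p34's passage), threshold `c₁ = 1/(23D²K(D, L, 𝓅))`.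
Imports: gen 23 `BIJ88Eq242HiggsCovariancePrintNorm`, p34 gen 19 `BIJ88NeumannPropagatorActualBackground`.  Literature + Mathlib only.
Unit `lit-balaban-p31` (literature-prover-lit-balaban-p31-g23-0), 2026-08-23.  NOT summit progress.
-/

open scoped BigOperators Matrix ComplexConjugate
open Finset Matrix

namespace Literature.MathematicalPhysics.QuantumFieldTheory.BalabanImbrieJaffe1984to88.BIJ88Eq242HiggsCovariancePrintNormActualBackground

open Literature.MathematicalPhysics.QuantumFieldTheory.Balaban1983to89
open BIJ88Sect3Statements (U1 toC)
open BIJ85BlockAveragesTorus BIJ85BlockAveragesTorusK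
open BIJ85Sect1Model (U1Field plaq)
open BIJ85AbelianStokes (plaqC)
open BIJ85Eq454PlaqResidual (actualBgU1)
open BIJ88NeumannPropagatorActualBackground (smallPlaquette_actualBg)
open BIJ88DeltaLoc234Torus (deltaLocT)
open BIJ88Cutoffs21 (cutoff)
open BIJ88LocWeights227Torus (cubeFam lamFam)
open BIJ88Eq240FlatTorus (realify compress op240 c240)
open B4Sect5Proof (latticeConst)
open BIJ88RandomWalk242 BIJ88Eq242Lattice BIJ88Ineq246Lattice B4Sect5CubeBounds
open BIJ88Eq242HiggsCovarianceTorus (chartSet reOp idxEquiv)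
open BIJ88Eq242HiggsCovarianceTorusCwt (E56)
open BIJ88Eq242HiggsCovariancePrintNorm

noncomputable section

variable {d : ℕ}

/-- **[6] (5.6) WITH `k`-UNIFORM CONSTANTS AND (2.40)-INVERTIBILITY FOR THE PRINT-NORMALIZED `(Δ^{print}_{k,loc}(u_k) + κ′P(u_k′))|_Λ` AT THE
ACTUAL BACKGROUND UNDER (7.3.1)**: `0 < γ_P ∧ 0 ≤ c_P ∧ B4.Hyp56 Λ′ (reOp Λ ·) γ_P c_P δ₀ ∧ IsUnit ((·)|_Λ)` at `θ = K·e𝓅(e)/(L^k)²` — gen 23's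
`hyp56_printNorm_smallPlaquette_torus_cwt` ∘ p34's `smallPlaquette_actualBg`.
[cite: BalabanImbrieJaffe1985, (7.3.1) p.326] [cite: BalabanImbrieJaffe1988, (2.40) p.264] [cite: Balaban1983RegularityDecay, (5.6) p.594] -/
theorem hyp56_printNorm_actualBg (d ℓ : ℕ) (hd1 : 1 ≤ d) (hd3 : d + 1 ≤ 3) (hℓ : 1 ≤ ℓ) (hodd : Odd (ℓ + 1)) {a : ℝ} (ha : 0 < a) (pexp : ℝ) :
    ∃ c₁ δ₀ c₀ K : ℝ, 0 < c₁ ∧ 0 < δ₀ ∧ 0 < c₀ ∧ 1 ≤ K ∧ ∀ (P : Params) (hPd : P.d = d + 1), P.L = ℓ + 1 →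
      ∀ (hd2 : 2 ≤ P.d) (k : ℕ), 1 ≤ k → k ≤ P.K → k + 1 ≤ P.m + P.K → 2 * (P.L ^ k - 1) + 4 < P.sitesPerDir 0 →
      ∀ (e : ℝ), 0 < e → e ≤ 1 → e * (1 + Real.log e⁻¹) ^ pexp ≤ c₁ →
      ∀ (v : U1Field P k), (∀ q : Balaban1983to89.Plaq P k, ‖((plaq v q : Circle) : ℂ) - 1‖ ≤ e * (1 + Real.log e⁻¹) ^ pexp) →
      ∀ (c M0 : Fin (d + 1) → ℕ), (∀ i, 1 ≤ M0 i) → (∀ i, c i * P.L ^ k + P.L ^ k * M0 i ≤ P.sitesPerDir 0) →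
        (∀ i, 2 * (P.L ^ k * M0 i) ≤ P.sitesPerDir 0) →
      ∀ (sg W : ℕ), 1 ≤ sg → ∀ (R R₀ R₁ : ℝ), 10 * (P.L : ℝ) ^ k < R → 0 ≤ R₁ → R₁ < R₀ →
        2 * (sg : ℝ) / 3 + R₀ / 2 + R ≤ W → (∀ i, ((P.L ^ k * M0 i : ℕ) : ℝ) + R ≤ P.sitesPerDir 0) →
      ∀ (Λ : Finset (Balaban1983to89.Site P (0 + k))),
        (∀ y₁ ∈ Λ, ∀ μ, (c (Fin.cast hPd μ) : ℝ) * P.L ^ k + (R₀ + R) ≤ (P.L : ℝ) ^ k * (y₁ μ).val ∧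
          (P.L : ℝ) ^ k * (y₁ μ).val + P.L ^ k + (R₀ + R) ≤ (c (Fin.cast hPd μ) : ℝ) * P.L ^ k + (P.L : ℝ) ^ k * M0 (Fin.cast hPd μ)) →
      ∀ (T₁ δ' σ : ℝ),
        (∀ b : PBond P (0 + k), blkIter 1 b.src = blkIter 1 b.tgt → ‖toC (lineIter (actualBgU1 hd2 k e v) k b) - 1‖ ≤ T₁) →
        (∀ y : Balaban1983to89.Site P (0 + k), ‖holCK (lineIter (actualBgU1 hd2 k e v) k) 1 y - 1‖ ≤ δ') →
        2 * (((P.L : ℝ) - 1) * P.L) * P.d * T₁ ^ 2 + 2 * δ' ^ 2 ≤ σ →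
      ∀ (κ' : ℝ), 0 ≤ κ' →
        4 / 3 * (P.d : ℝ) ^ 4 * (((P.L : ℝ) ^ k) ^ 2 * (K * (e * (1 + Real.log e⁻¹) ^ pexp) / ((P.L : ℝ) ^ k) ^ 2)) ^ 2 +
            B1.aSeq a P.L k ^ 2 * (c₀ * Real.exp (δ₀ / 2) * latticeConst P.d (δ₀ / 2)) *
              (((⌊(((P.L : ℝ) ^ k) - 1 + R₀) / sg⌋₊ : ℝ) + 3) ^ (d + 1) *
                  Real.exp (-(δ₀ * (((P.L : ℝ) ^ k)⁻¹ * (2 * R)))) +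
                Real.exp (-(δ₀ / 2 * (((P.L : ℝ) ^ k)⁻¹ * R₁)))) <
          c240 P (min (a / (9 * (P.d + 1))) (1 / 12)) κ' * (1 - σ) →
      0 < gammaP P a k (K * (e * (1 + Real.log e⁻¹) ^ pexp) / ((P.L : ℝ) ^ k) ^ 2) c₀ δ₀ ((⌊(((P.L : ℝ) ^ k) - 1 + R₀) / sg⌋₊ + 3) ^ (d + 1)) R R₁ σ κ' ∧
      0 ≤ cP P a k c₀ δ₀ ((⌊(((P.L : ℝ) ^ k) - 1 + R₀) / sg⌋₊ + 3) ^ (d + 1)) κ' ∧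
      B4.Hyp56 (chartSet Λ)
          (reOp Λ (op240
            ((((B1.aSeq a P.L k / (B1RG242Torus.α P a k * (P.L : ℝ) ^ (k * P.d))) : ℝ) : ℂ) •
              deltaLocT (B1RG242Torus.α P a k * (P.L : ℝ) ^ (k * P.d)) P.eps⁻¹ (actualBgU1 hd2 k e v) k (cubeFam hPd (P.L ^ k) c M0 sg W)
                (lamFam hPd (P.L ^ k) c M0 sg) (cutoff R₁ R₀ (B5Ineq137Torus.T P 0)))
            κ' (lineIter (actualBgU1 hd2 k e v) k)))
          (gammaP P a k (K * (e * (1 + Real.log e⁻¹) ^ pexp) / ((P.L : ℝ) ^ k) ^ 2) c₀ δ₀ ((⌊(((P.L : ℝ) ^ k) - 1 + R₀) / sg⌋₊ + 3) ^ (d + 1)) R R₁ σ κ')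
          (cP P a k c₀ δ₀ ((⌊(((P.L : ℝ) ^ k) - 1 + R₀) / sg⌋₊ + 3) ^ (d + 1)) κ') δ₀ ∧
      IsUnit (compress Λ (op240
            ((((B1.aSeq a P.L k / (B1RG242Torus.α P a k * (P.L : ℝ) ^ (k * P.d))) : ℝ) : ℂ) •
              deltaLocT (B1RG242Torus.α P a k * (P.L : ℝ) ^ (k * P.d)) P.eps⁻¹ (actualBgU1 hd2 k e v) k (cubeFam hPd (P.L ^ k) c M0 sg W)
                (lamFam hPd (P.L ^ k) c M0 sg) (cutoff R₁ R₀ (B5Ineq137Torus.T P 0)))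
            κ' (lineIter (actualBgU1 hd2 k e v) k))) := by
  obtain ⟨K, hK1, HK⟩ := smallPlaquette_actualBg (d := d + 1) (L := ℓ + 1) (by omega) pexp
  obtain ⟨δ₀, c₀, hδ₀, hc₀, H⟩ := hyp56_printNorm_smallPlaquette_torus_cwt d ℓ hd1 hd3 hℓ hodd ha
  refine ⟨1 / (23 * ((d : ℝ) + 1) ^ 2 * K), δ₀, c₀, K, by positivity, hδ₀, hc₀, hK1, ?_⟩
  intro P hPd hPL hd2 k hk1 hkK hk' hbig e he he1 hsm v hv c M0 hM0 hfit0 hhalf sg W hsg R R₀ R₁ hRm hR₁ hR10 hW hgap Λ hΛ T₁ δ' σ hInt hTree hσ κ' hκ' hE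
  have hk : k ≤ P.m + P.K := hkK.trans (Nat.le_add_left _ _)
  have hdr : (P.d : ℝ) = (d : ℝ) + 1 := by rw [hPd]; push_cast; ring
  rw [← hdr] at hsm
  obtain ⟨hθ0, hplaq, -, -, -, -, hτ⟩ := HK P hPd hPL hd2 k hk1 hk e he he1 hsm v hv
  exact H P hPd hPL k hk1 hkK hk' hbig (actualBgU1 hd2 k e v) _ hθ0 hplaq hτ c M0 hM0 hfit0 hhalf sg W hsg R R₀ R₁ hRm hR₁ hR10 hW hgap Λ hΛ T₁ δ' σ
    hInt hTree hσ κ' hκ' hE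

/-- **(2.42) FOR THE PRINT-NORMALIZED `C^{(k)}_Λ(u_k)` AT THE ACTUAL BACKGROUND, `k`-UNIFORM CUBE CONDITIONS** (`M ≥ 5`, `M > K_R(γ_P, c_P, δ₀)`,
`M > Θ₁(γ_P, c_P, δ₀)`): the unconditional `HasSum` in `ℂ` over all walks — gen 23's `eq242_printNorm_smallPlaquette_torus_cwt` ∘ p34's passage.
[cite: BalabanImbrieJaffe1985, (7.3.1) p.326] [cite: BalabanImbrieJaffe1988, (2.42) p.264] -/
theorem eq242_printNorm_actualBg (d ℓ : ℕ) (hd1 : 1 ≤ d) (hd3 : d + 1 ≤ 3) (hℓ : 1 ≤ ℓ) (hodd : Odd (ℓ + 1)) {a : ℝ} (ha : 0 < a) (pexp : ℝ) :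
    ∃ c₁ δ₀ c₀ K : ℝ, 0 < c₁ ∧ 0 < δ₀ ∧ 0 < c₀ ∧ 1 ≤ K ∧ ∀ (P : Params) (hPd : P.d = d + 1), P.L = ℓ + 1 →
      ∀ (hd2 : 2 ≤ P.d) (k : ℕ), 1 ≤ k → k ≤ P.K → k + 1 ≤ P.m + P.K → 2 * (P.L ^ k - 1) + 4 < P.sitesPerDir 0 →
      ∀ (e : ℝ), 0 < e → e ≤ 1 → e * (1 + Real.log e⁻¹) ^ pexp ≤ c₁ →
      ∀ (v : U1Field P k), (∀ q : Balaban1983to89.Plaq P k, ‖((plaq v q : Circle) : ℂ) - 1‖ ≤ e * (1 + Real.log e⁻¹) ^ pexp) →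
      ∀ (c M0 : Fin (d + 1) → ℕ), (∀ i, 1 ≤ M0 i) → (∀ i, c i * P.L ^ k + P.L ^ k * M0 i ≤ P.sitesPerDir 0) →
        (∀ i, 2 * (P.L ^ k * M0 i) ≤ P.sitesPerDir 0) →
      ∀ (sg W : ℕ), 1 ≤ sg → ∀ (R R₀ R₁ : ℝ), 10 * (P.L : ℝ) ^ k < R → 0 ≤ R₁ → R₁ < R₀ →
        2 * (sg : ℝ) / 3 + R₀ / 2 + R ≤ W → (∀ i, ((P.L ^ k * M0 i : ℕ) : ℝ) + R ≤ P.sitesPerDir 0) →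
      ∀ (Λ : Finset (Balaban1983to89.Site P (0 + k))),
        (∀ y₁ ∈ Λ, ∀ μ, (c (Fin.cast hPd μ) : ℝ) * P.L ^ k + (R₀ + R) ≤ (P.L : ℝ) ^ k * (y₁ μ).val ∧
          (P.L : ℝ) ^ k * (y₁ μ).val + P.L ^ k + (R₀ + R) ≤ (c (Fin.cast hPd μ) : ℝ) * P.L ^ k + (P.L : ℝ) ^ k * M0 (Fin.cast hPd μ)) →
      ∀ (T₁ δ' σ : ℝ),
        (∀ b : PBond P (0 + k), blkIter 1 b.src = blkIter 1 b.tgt → ‖toC (lineIter (actualBgU1 hd2 k e v) k b) - 1‖ ≤ T₁) →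
        (∀ y : Balaban1983to89.Site P (0 + k), ‖holCK (lineIter (actualBgU1 hd2 k e v) k) 1 y - 1‖ ≤ δ') →
        2 * (((P.L : ℝ) - 1) * P.L) * P.d * T₁ ^ 2 + 2 * δ' ^ 2 ≤ σ →
      ∀ (κ' : ℝ), 0 ≤ κ' →
        4 / 3 * (P.d : ℝ) ^ 4 * (((P.L : ℝ) ^ k) ^ 2 * (K * (e * (1 + Real.log e⁻¹) ^ pexp) / ((P.L : ℝ) ^ k) ^ 2)) ^ 2 +
            B1.aSeq a P.L k ^ 2 * (c₀ * Real.exp (δ₀ / 2) * latticeConst P.d (δ₀ / 2)) *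
              (((⌊(((P.L : ℝ) ^ k) - 1 + R₀) / sg⌋₊ : ℝ) + 3) ^ (d + 1) *
                  Real.exp (-(δ₀ * (((P.L : ℝ) ^ k)⁻¹ * (2 * R)))) +
                Real.exp (-(δ₀ / 2 * (((P.L : ℝ) ^ k)⁻¹ * R₁)))) <
          c240 P (min (a / (9 * (P.d + 1))) (1 / 12)) κ' * (1 - σ) →
      ∀ (M : ℕ), 5 ≤ M → kR P.d 2 (gammaP P a k (K * (e * (1 + Real.log e⁻¹) ^ pexp) / ((P.L : ℝ) ^ k) ^ 2) c₀ δ₀ ((⌊(((P.L : ℝ) ^ k) - 1 + R₀) / sg⌋₊ + 3) ^ (d + 1)) R R₁ σ κ') (cP P a k c₀ δ₀ ((⌊(((P.L : ℝ) ^ k) - 1 + R₀) / sg⌋₊ + 3) ^ (d + 1)) κ') δ₀ < M →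
        thetaConst P.d 2 (gammaP P a k (K * (e * (1 + Real.log e⁻¹) ^ pexp) / ((P.L : ℝ) ^ k) ^ 2) c₀ δ₀ ((⌊(((P.L : ℝ) ^ k) - 1 + R₀) / sg⌋₊ + 3) ^ (d + 1)) R R₁ σ κ') (cP P a k c₀ δ₀ ((⌊(((P.L : ℝ) ^ k) - 1 + R₀) / sg⌋₊ + 3) ^ (d + 1)) κ') δ₀ < M →
      ∀ (x₁ x₂ : ↥Λ),
        HasSum (fun ω : Walk ↥(B4Sect5CubeBounds.labels M (chartSet Λ)) =>
            (⟨latticeCw M (chartSet Λ) 2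
                  (reOp Λ (op240
            ((((B1.aSeq a P.L k / (B1RG242Torus.α P a k * (P.L : ℝ) ^ (k * P.d))) : ℝ) : ℂ) •
              deltaLocT (B1RG242Torus.α P a k * (P.L : ℝ) ^ (k * P.d)) P.eps⁻¹ (actualBgU1 hd2 k e v) k (cubeFam hPd (P.L ^ k) c M0 sg W)
                (lamFam hPd (P.L ^ k) c M0 sg) (cutoff R₁ R₀ (B5Ineq137Torus.T P 0)))
            κ' (lineIter (actualBgU1 hd2 k e v) k))) ω (idxEquiv Λ (x₁, 0)) (idxEquiv Λ (x₂, 0)),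
              latticeCw M (chartSet Λ) 2
                  (reOp Λ (op240
            ((((B1.aSeq a P.L k / (B1RG242Torus.α P a k * (P.L : ℝ) ^ (k * P.d))) : ℝ) : ℂ) •
              deltaLocT (B1RG242Torus.α P a k * (P.L : ℝ) ^ (k * P.d)) P.eps⁻¹ (actualBgU1 hd2 k e v) k (cubeFam hPd (P.L ^ k) c M0 sg W)
                (lamFam hPd (P.L ^ k) c M0 sg) (cutoff R₁ R₀ (B5Ineq137Torus.T P 0)))
            κ' (lineIter (actualBgU1 hd2 k e v) k))) ω (idxEquiv Λ (x₁, 1)) (idxEquiv Λ (x₂, 0))⟩ : ℂ))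
          ((compress Λ (op240
            ((((B1.aSeq a P.L k / (B1RG242Torus.α P a k * (P.L : ℝ) ^ (k * P.d))) : ℝ) : ℂ) •
              deltaLocT (B1RG242Torus.α P a k * (P.L : ℝ) ^ (k * P.d)) P.eps⁻¹ (actualBgU1 hd2 k e v) k (cubeFam hPd (P.L ^ k) c M0 sg W)
                (lamFam hPd (P.L ^ k) c M0 sg) (cutoff R₁ R₀ (B5Ineq137Torus.T P 0)))
            κ' (lineIter (actualBgU1 hd2 k e v) k)))⁻¹ x₁ x₂) := by
  obtain ⟨K, hK1, HK⟩ := smallPlaquette_actualBg (d := d + 1) (L := ℓ + 1) (by omega) pexp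
  obtain ⟨δ₀, c₀, hδ₀, hc₀, H⟩ := eq242_printNorm_smallPlaquette_torus_cwt d ℓ hd1 hd3 hℓ hodd ha
  refine ⟨1 / (23 * ((d : ℝ) + 1) ^ 2 * K), δ₀, c₀, K, by positivity, hδ₀, hc₀, hK1, ?_⟩
  intro P hPd hPL hd2 k hk1 hkK hk' hbig e he he1 hsm v hv c M0 hM0 hfit0 hhalf sg W hsg R R₀ R₁ hRm hR₁ hR10 hW hgap Λ hΛ T₁ δ' σ hInt hTree hσ κ' hκ' hE M hM hMR hMθ x₁ x₂
  have hk : k ≤ P.m + P.K := hkK.trans (Nat.le_add_left _ _)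
  have hdr : (P.d : ℝ) = (d : ℝ) + 1 := by rw [hPd]; push_cast; ring
  rw [← hdr] at hsm
  obtain ⟨hθ0, hplaq, -, -, -, -, hτ⟩ := HK P hPd hPL hd2 k hk1 hk e he he1 hsm v hv
  exact H P hPd hPL k hk1 hkK hk' hbig (actualBgU1 hd2 k e v) _ hθ0 hplaq hτ c M0 hM0 hfit0 hhalf sg W hsg R R₀ R₁ hRm hR₁ hR10 hW hgap Λ hΛ T₁ δ' σ
    hInt hTree hσ κ' hκ' hE M hM hMR hMθ x₁ x₂

/-- **(2.45) FOR THE PRINT-NORMALIZED `C^{(k)}_Λ(u_k)` AT THE ACTUAL BACKGROUND** (typed `Eq245`, every `ρ`, `s`) — gen 23's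
`eq245_printNorm_smallPlaquette_torus_cwt` ∘ p34's passage. [cite: BalabanImbrieJaffe1985, (7.3.1) p.326] [cite: BalabanImbrieJaffe1988, (2.45) p.264] -/
theorem eq245_printNorm_actualBg (d ℓ : ℕ) (hd1 : 1 ≤ d) (hd3 : d + 1 ≤ 3) (hℓ : 1 ≤ ℓ) (hodd : Odd (ℓ + 1)) {a : ℝ} (ha : 0 < a) (pexp : ℝ) :
    ∃ c₁ δ₀ c₀ K : ℝ, 0 < c₁ ∧ 0 < δ₀ ∧ 0 < c₀ ∧ 1 ≤ K ∧ ∀ (P : Params) (hPd : P.d = d + 1), P.L = ℓ + 1 →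
      ∀ (hd2 : 2 ≤ P.d) (k : ℕ), 1 ≤ k → k ≤ P.K → k + 1 ≤ P.m + P.K → 2 * (P.L ^ k - 1) + 4 < P.sitesPerDir 0 →
      ∀ (e : ℝ), 0 < e → e ≤ 1 → e * (1 + Real.log e⁻¹) ^ pexp ≤ c₁ →
      ∀ (v : U1Field P k), (∀ q : Balaban1983to89.Plaq P k, ‖((plaq v q : Circle) : ℂ) - 1‖ ≤ e * (1 + Real.log e⁻¹) ^ pexp) →
      ∀ (c M0 : Fin (d + 1) → ℕ), (∀ i, 1 ≤ M0 i) → (∀ i, c i * P.L ^ k + P.L ^ k * M0 i ≤ P.sitesPerDir 0) →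
        (∀ i, 2 * (P.L ^ k * M0 i) ≤ P.sitesPerDir 0) →
      ∀ (sg W : ℕ), 1 ≤ sg → ∀ (R R₀ R₁ : ℝ), 10 * (P.L : ℝ) ^ k < R → 0 ≤ R₁ → R₁ < R₀ →
        2 * (sg : ℝ) / 3 + R₀ / 2 + R ≤ W → (∀ i, ((P.L ^ k * M0 i : ℕ) : ℝ) + R ≤ P.sitesPerDir 0) →
      ∀ (Λ : Finset (Balaban1983to89.Site P (0 + k))),
        (∀ y₁ ∈ Λ, ∀ μ, (c (Fin.cast hPd μ) : ℝ) * P.L ^ k + (R₀ + R) ≤ (P.L : ℝ) ^ k * (y₁ μ).val ∧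
          (P.L : ℝ) ^ k * (y₁ μ).val + P.L ^ k + (R₀ + R) ≤ (c (Fin.cast hPd μ) : ℝ) * P.L ^ k + (P.L : ℝ) ^ k * M0 (Fin.cast hPd μ)) →
      ∀ (T₁ δ' σ : ℝ),
        (∀ b : PBond P (0 + k), blkIter 1 b.src = blkIter 1 b.tgt → ‖toC (lineIter (actualBgU1 hd2 k e v) k b) - 1‖ ≤ T₁) →
        (∀ y : Balaban1983to89.Site P (0 + k), ‖holCK (lineIter (actualBgU1 hd2 k e v) k) 1 y - 1‖ ≤ δ') →
        2 * (((P.L : ℝ) - 1) * P.L) * P.d * T₁ ^ 2 + 2 * δ' ^ 2 ≤ σ →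
      ∀ (κ' : ℝ), 0 ≤ κ' →
        4 / 3 * (P.d : ℝ) ^ 4 * (((P.L : ℝ) ^ k) ^ 2 * (K * (e * (1 + Real.log e⁻¹) ^ pexp) / ((P.L : ℝ) ^ k) ^ 2)) ^ 2 +
            B1.aSeq a P.L k ^ 2 * (c₀ * Real.exp (δ₀ / 2) * latticeConst P.d (δ₀ / 2)) *
              (((⌊(((P.L : ℝ) ^ k) - 1 + R₀) / sg⌋₊ : ℝ) + 3) ^ (d + 1) *
                  Real.exp (-(δ₀ * (((P.L : ℝ) ^ k)⁻¹ * (2 * R)))) +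
                Real.exp (-(δ₀ / 2 * (((P.L : ℝ) ^ k)⁻¹ * R₁)))) <
          c240 P (min (a / (9 * (P.d + 1))) (1 / 12)) κ' * (1 - σ) →
      ∀ (M : ℕ), 5 ≤ M → kR P.d 2 (gammaP P a k (K * (e * (1 + Real.log e⁻¹) ^ pexp) / ((P.L : ℝ) ^ k) ^ 2) c₀ δ₀ ((⌊(((P.L : ℝ) ^ k) - 1 + R₀) / sg⌋₊ + 3) ^ (d + 1)) R R₁ σ κ') (cP P a k c₀ δ₀ ((⌊(((P.L : ℝ) ^ k) - 1 + R₀) / sg⌋₊ + 3) ^ (d + 1)) κ') δ₀ < M →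
        thetaConst P.d 2 (gammaP P a k (K * (e * (1 + Real.log e⁻¹) ^ pexp) / ((P.L : ℝ) ^ k) ^ 2) c₀ δ₀ ((⌊(((P.L : ℝ) ^ k) - 1 + R₀) / sg⌋₊ + 3) ^ (d + 1)) R R₁ σ κ') (cP P a k c₀ δ₀ ((⌊(((P.L : ℝ) ^ k) - 1 + R₀) / sg⌋₊ + 3) ^ (d + 1)) κ') δ₀ < M →
      ∀ (ρ : ℝ) (s : ℕ),
        BIJ88Sect2Statements.Eq245
          (fun p q : ↥Λ × Fin 2 => realify (compress Λ (op240
            ((((B1.aSeq a P.L k / (B1RG242Torus.α P a k * (P.L : ℝ) ^ (k * P.d))) : ℝ) : ℂ) •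
              deltaLocT (B1RG242Torus.α P a k * (P.L : ℝ) ^ (k * P.d)) P.eps⁻¹ (actualBgU1 hd2 k e v) k (cubeFam hPd (P.L ^ k) c M0 sg W)
                (lamFam hPd (P.L ^ k) c M0 sg) (cutoff R₁ R₀ (B5Ineq137Torus.T P 0)))
            κ' (lineIter (actualBgU1 hd2 k e v) k)))⁻¹ p q)
          (fun p q => cLoc (ldist (N := 2) M) ρ (fun ω y₁ y₂ => latticeCw M (chartSet Λ) 2
              (reOp Λ (op240
            ((((B1.aSeq a P.L k / (B1RG242Torus.α P a k * (P.L : ℝ) ^ (k * P.d))) : ℝ) : ℂ) •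
              deltaLocT (B1RG242Torus.α P a k * (P.L : ℝ) ^ (k * P.d)) P.eps⁻¹ (actualBgU1 hd2 k e v) k (cubeFam hPd (P.L ^ k) c M0 sg W)
                (lamFam hPd (P.L ^ k) c M0 sg) (cutoff R₁ R₀ (B5Ineq137Torus.T P 0)))
            κ' (lineIter (actualBgU1 hd2 k e v) k))) ω y₁ y₂) (idxEquiv Λ p) (idxEquiv Λ q))
          (fun X p q => cX (ldist (N := 2) M) ρ (cubeOf M s) touch (fun ω y₁ y₂ => latticeCw M (chartSet Λ) 2
              (reOp Λ (op240
            ((((B1.aSeq a P.L k / (B1RG242Torus.α P a k * (P.L : ℝ) ^ (k * P.d))) : ℝ) : ℂ) •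
              deltaLocT (B1RG242Torus.α P a k * (P.L : ℝ) ^ (k * P.d)) P.eps⁻¹ (actualBgU1 hd2 k e v) k (cubeFam hPd (P.L ^ k) c M0 sg W)
                (lamFam hPd (P.L ^ k) c M0 sg) (cutoff R₁ R₀ (B5Ineq137Torus.T P 0)))
            κ' (lineIter (actualBgU1 hd2 k e v) k))) ω y₁ y₂) X (idxEquiv Λ p) (idxEquiv Λ q)) := by
  obtain ⟨K, hK1, HK⟩ := smallPlaquette_actualBg (d := d + 1) (L := ℓ + 1) (by omega) pexp
  obtain ⟨δ₀, c₀, hδ₀, hc₀, H⟩ := eq245_printNorm_smallPlaquette_torus_cwt d ℓ hd1 hd3 hℓ hodd ha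
  refine ⟨1 / (23 * ((d : ℝ) + 1) ^ 2 * K), δ₀, c₀, K, by positivity, hδ₀, hc₀, hK1, ?_⟩
  intro P hPd hPL hd2 k hk1 hkK hk' hbig e he he1 hsm v hv c M0 hM0 hfit0 hhalf sg W hsg R R₀ R₁ hRm hR₁ hR10 hW hgap Λ hΛ T₁ δ' σ hInt hTree hσ κ' hκ' hE M hM hMR hMθ ρ s
  have hk : k ≤ P.m + P.K := hkK.trans (Nat.le_add_left _ _)
  have hdr : (P.d : ℝ) = (d : ℝ) + 1 := by rw [hPd]; push_cast; ring
  rw [← hdr] at hsm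
  obtain ⟨hθ0, hplaq, -, -, -, -, hτ⟩ := HK P hPd hPL hd2 k hk1 hk e he he1 hsm v hv
  exact H P hPd hPL k hk1 hkK hk' hbig (actualBgU1 hd2 k e v) _ hθ0 hplaq hτ c M0 hM0 hfit0 hhalf sg W hsg R R₀ R₁ hRm hR₁ hR10 hW hgap Λ hΛ T₁ δ' σ
    hInt hTree hσ κ' hκ' hE M hM hMR hMθ ρ s

/-- **(2.41) BY THE WALK ROUTE FOR THE PRINT-NORMALIZED `C^{(k)}_Λ(u_k)` AT THE ACTUAL BACKGROUND, `k`-UNIFORM CONSTANTS**: with `θ_W < 1`,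
`‖C^{(k)}_Λ(u_k; x₁, x₂)‖ ≤ 2·2^{D}γ_P^{−1}(1 − θ_W)^{−1}e^{δ₀/4}·e^{−(δ₀/8)|x₁−x₂|_T/M}` — gen 23's `decay241_walk_printNorm_smallPlaquette_torus_cwt` ∘
p34's passage. [cite: BalabanImbrieJaffe1985, (7.3.1) p.326] [cite: BalabanImbrieJaffe1988, (2.41) p.264] -/
theorem decay241_walk_printNorm_actualBg (d ℓ : ℕ) (hd1 : 1 ≤ d) (hd3 : d + 1 ≤ 3) (hℓ : 1 ≤ ℓ) (hodd : Odd (ℓ + 1)) {a : ℝ} (ha : 0 < a)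
    (pexp : ℝ) :
    ∃ c₁ δ₀ c₀ K : ℝ, 0 < c₁ ∧ 0 < δ₀ ∧ 0 < c₀ ∧ 1 ≤ K ∧ ∀ (P : Params) (hPd : P.d = d + 1), P.L = ℓ + 1 →
      ∀ (hd2 : 2 ≤ P.d) (k : ℕ), 1 ≤ k → k ≤ P.K → k + 1 ≤ P.m + P.K → 2 * (P.L ^ k - 1) + 4 < P.sitesPerDir 0 →
      ∀ (e : ℝ), 0 < e → e ≤ 1 → e * (1 + Real.log e⁻¹) ^ pexp ≤ c₁ →
      ∀ (v : U1Field P k), (∀ q : Balaban1983to89.Plaq P k, ‖((plaq v q : Circle) : ℂ) - 1‖ ≤ e * (1 + Real.log e⁻¹) ^ pexp) →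
      ∀ (c M0 : Fin (d + 1) → ℕ), (∀ i, 1 ≤ M0 i) → (∀ i, c i * P.L ^ k + P.L ^ k * M0 i ≤ P.sitesPerDir 0) →
        (∀ i, 2 * (P.L ^ k * M0 i) ≤ P.sitesPerDir 0) →
      ∀ (sg W : ℕ), 1 ≤ sg → ∀ (R R₀ R₁ : ℝ), 10 * (P.L : ℝ) ^ k < R → 0 ≤ R₁ → R₁ < R₀ →
        2 * (sg : ℝ) / 3 + R₀ / 2 + R ≤ W → (∀ i, ((P.L ^ k * M0 i : ℕ) : ℝ) + R ≤ P.sitesPerDir 0) →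
      ∀ (Λ : Finset (Balaban1983to89.Site P (0 + k))),
        (∀ y₁ ∈ Λ, ∀ μ, (c (Fin.cast hPd μ) : ℝ) * P.L ^ k + (R₀ + R) ≤ (P.L : ℝ) ^ k * (y₁ μ).val ∧
          (P.L : ℝ) ^ k * (y₁ μ).val + P.L ^ k + (R₀ + R) ≤ (c (Fin.cast hPd μ) : ℝ) * P.L ^ k + (P.L : ℝ) ^ k * M0 (Fin.cast hPd μ)) →
      ∀ (T₁ δ' σ : ℝ),
        (∀ b : PBond P (0 + k), blkIter 1 b.src = blkIter 1 b.tgt → ‖toC (lineIter (actualBgU1 hd2 k e v) k b) - 1‖ ≤ T₁) →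
        (∀ y : Balaban1983to89.Site P (0 + k), ‖holCK (lineIter (actualBgU1 hd2 k e v) k) 1 y - 1‖ ≤ δ') →
        2 * (((P.L : ℝ) - 1) * P.L) * P.d * T₁ ^ 2 + 2 * δ' ^ 2 ≤ σ →
      ∀ (κ' : ℝ), 0 ≤ κ' →
        4 / 3 * (P.d : ℝ) ^ 4 * (((P.L : ℝ) ^ k) ^ 2 * (K * (e * (1 + Real.log e⁻¹) ^ pexp) / ((P.L : ℝ) ^ k) ^ 2)) ^ 2 +
            B1.aSeq a P.L k ^ 2 * (c₀ * Real.exp (δ₀ / 2) * latticeConst P.d (δ₀ / 2)) *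
              (((⌊(((P.L : ℝ) ^ k) - 1 + R₀) / sg⌋₊ : ℝ) + 3) ^ (d + 1) *
                  Real.exp (-(δ₀ * (((P.L : ℝ) ^ k)⁻¹ * (2 * R)))) +
                Real.exp (-(δ₀ / 2 * (((P.L : ℝ) ^ k)⁻¹ * R₁)))) <
          c240 P (min (a / (9 * (P.d + 1))) (1 / 12)) κ' * (1 - σ) →
      ∀ (M : ℕ), 5 ≤ M → kR P.d 2 (gammaP P a k (K * (e * (1 + Real.log e⁻¹) ^ pexp) / ((P.L : ℝ) ^ k) ^ 2) c₀ δ₀ ((⌊(((P.L : ℝ) ^ k) - 1 + R₀) / sg⌋₊ + 3) ^ (d + 1)) R R₁ σ κ') (cP P a k c₀ δ₀ ((⌊(((P.L : ℝ) ^ k) - 1 + R₀) / sg⌋₊ + 3) ^ (d + 1)) κ') δ₀ < M →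
        thetaConst P.d 2 (gammaP P a k (K * (e * (1 + Real.log e⁻¹) ^ pexp) / ((P.L : ℝ) ^ k) ^ 2) c₀ δ₀ ((⌊(((P.L : ℝ) ^ k) - 1 + R₀) / sg⌋₊ + 3) ^ (d + 1)) R R₁ σ κ') (cP P a k c₀ δ₀ ((⌊(((P.L : ℝ) ^ k) - 1 + R₀) / sg⌋₊ + 3) ^ (d + 1)) κ') δ₀ < M →
        thetaW P.d 2 (gammaP P a k (K * (e * (1 + Real.log e⁻¹) ^ pexp) / ((P.L : ℝ) ^ k) ^ 2) c₀ δ₀ ((⌊(((P.L : ℝ) ^ k) - 1 + R₀) / sg⌋₊ + 3) ^ (d + 1)) R R₁ σ κ') (cP P a k c₀ δ₀ ((⌊(((P.L : ℝ) ^ k) - 1 + R₀) / sg⌋₊ + 3) ^ (d + 1)) κ') δ₀ M < 1 →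
      ∀ (x₁ x₂ : ↥Λ),
        ‖(compress Λ (op240
            ((((B1.aSeq a P.L k / (B1RG242Torus.α P a k * (P.L : ℝ) ^ (k * P.d))) : ℝ) : ℂ) •
              deltaLocT (B1RG242Torus.α P a k * (P.L : ℝ) ^ (k * P.d)) P.eps⁻¹ (actualBgU1 hd2 k e v) k (cubeFam hPd (P.L ^ k) c M0 sg W)
                (lamFam hPd (P.L ^ k) c M0 sg) (cutoff R₁ R₀ (B5Ineq137Torus.T P 0)))
            κ' (lineIter (actualBgU1 hd2 k e v) k)))⁻¹ x₁ x₂‖ ≤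
          2 * (2 ^ P.d * (gammaP P a k (K * (e * (1 + Real.log e⁻¹) ^ pexp) / ((P.L : ℝ) ^ k) ^ 2) c₀ δ₀ ((⌊(((P.L : ℝ) ^ k) - 1 + R₀) / sg⌋₊ + 3) ^ (d + 1)) R R₁ σ κ')⁻¹ *
              (1 - thetaW P.d 2 (gammaP P a k (K * (e * (1 + Real.log e⁻¹) ^ pexp) / ((P.L : ℝ) ^ k) ^ 2) c₀ δ₀ ((⌊(((P.L : ℝ) ^ k) - 1 + R₀) / sg⌋₊ + 3) ^ (d + 1)) R R₁ σ κ')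
                (cP P a k c₀ δ₀ ((⌊(((P.L : ℝ) ^ k) - 1 + R₀) / sg⌋₊ + 3) ^ (d + 1)) κ') δ₀ M)⁻¹ *
              Real.exp (δ₀ / 4)) *
            Real.exp (-(δ₀ / 8) * (B5Ineq137Torus.T P (0 + k) x₁.1 x₂.1 / M)) := by
  obtain ⟨K, hK1, HK⟩ := smallPlaquette_actualBg (d := d + 1) (L := ℓ + 1) (by omega) pexp
  obtain ⟨δ₀, c₀, hδ₀, hc₀, H⟩ := decay241_walk_printNorm_smallPlaquette_torus_cwt d ℓ hd1 hd3 hℓ hodd ha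
  refine ⟨1 / (23 * ((d : ℝ) + 1) ^ 2 * K), δ₀, c₀, K, by positivity, hδ₀, hc₀, hK1, ?_⟩
  intro P hPd hPL hd2 k hk1 hkK hk' hbig e he he1 hsm v hv c M0 hM0 hfit0 hhalf sg W hsg R R₀ R₁ hRm hR₁ hR10 hW hgap Λ hΛ T₁ δ' σ hInt hTree hσ κ' hκ' hE M hM hMR hMθ hθW x₁ x₂
  have hk : k ≤ P.m + P.K := hkK.trans (Nat.le_add_left _ _)
  have hdr : (P.d : ℝ) = (d : ℝ) + 1 := by rw [hPd]; push_cast; ring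
  rw [← hdr] at hsm
  obtain ⟨hθ0, hplaq, -, -, -, -, hτ⟩ := HK P hPd hPL hd2 k hk1 hk e he he1 hsm v hv
  exact H P hPd hPL k hk1 hkK hk' hbig (actualBgU1 hd2 k e v) _ hθ0 hplaq hτ c M0 hM0 hfit0 hhalf sg W hsg R R₀ R₁ hRm hR₁ hR10 hW hgap Λ hΛ T₁ δ' σ
    hInt hTree hσ κ' hκ' hE M hM hMR hMθ hθW x₁ x₂

/-- **(2.46) (typed `Ineq246`) FOR THE PRINT-NORMALIZED `C^{(k)}_Λ(u_k)` AT THE ACTUAL BACKGROUND, `k`-UNIFORM CONSTANTS** — gen 23's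
`ineq246_printNorm_smallPlaquette_torus_cwt` ∘ p34's passage. [cite: BalabanImbrieJaffe1985, (7.3.1) p.326] [cite: BalabanImbrieJaffe1988, (2.46) p.264] -/
theorem ineq246_printNorm_actualBg (d ℓ : ℕ) (hd1 : 1 ≤ d) (hd3 : d + 1 ≤ 3) (hℓ : 1 ≤ ℓ) (hodd : Odd (ℓ + 1)) {a : ℝ} (ha : 0 < a) (pexp : ℝ) :
    ∃ c₁ δ₀ c₀ K : ℝ, 0 < c₁ ∧ 0 < δ₀ ∧ 0 < c₀ ∧ 1 ≤ K ∧ ∀ (P : Params) (hPd : P.d = d + 1), P.L = ℓ + 1 →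
      ∀ (hd2 : 2 ≤ P.d) (k : ℕ), 1 ≤ k → k ≤ P.K → k + 1 ≤ P.m + P.K → 2 * (P.L ^ k - 1) + 4 < P.sitesPerDir 0 →
      ∀ (e : ℝ), 0 < e → e ≤ 1 → e * (1 + Real.log e⁻¹) ^ pexp ≤ c₁ →
      ∀ (v : U1Field P k), (∀ q : Balaban1983to89.Plaq P k, ‖((plaq v q : Circle) : ℂ) - 1‖ ≤ e * (1 + Real.log e⁻¹) ^ pexp) →
      ∀ (c M0 : Fin (d + 1) → ℕ), (∀ i, 1 ≤ M0 i) → (∀ i, c i * P.L ^ k + P.L ^ k * M0 i ≤ P.sitesPerDir 0) →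
        (∀ i, 2 * (P.L ^ k * M0 i) ≤ P.sitesPerDir 0) →
      ∀ (sg W : ℕ), 1 ≤ sg → ∀ (R R₀ R₁ : ℝ), 10 * (P.L : ℝ) ^ k < R → 0 ≤ R₁ → R₁ < R₀ →
        2 * (sg : ℝ) / 3 + R₀ / 2 + R ≤ W → (∀ i, ((P.L ^ k * M0 i : ℕ) : ℝ) + R ≤ P.sitesPerDir 0) →
      ∀ (Λ : Finset (Balaban1983to89.Site P (0 + k))),
        (∀ y₁ ∈ Λ, ∀ μ, (c (Fin.cast hPd μ) : ℝ) * P.L ^ k + (R₀ + R) ≤ (P.L : ℝ) ^ k * (y₁ μ).val ∧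
          (P.L : ℝ) ^ k * (y₁ μ).val + P.L ^ k + (R₀ + R) ≤ (c (Fin.cast hPd μ) : ℝ) * P.L ^ k + (P.L : ℝ) ^ k * M0 (Fin.cast hPd μ)) →
      ∀ (T₁ δ' σ : ℝ),
        (∀ b : PBond P (0 + k), blkIter 1 b.src = blkIter 1 b.tgt → ‖toC (lineIter (actualBgU1 hd2 k e v) k b) - 1‖ ≤ T₁) →
        (∀ y : Balaban1983to89.Site P (0 + k), ‖holCK (lineIter (actualBgU1 hd2 k e v) k) 1 y - 1‖ ≤ δ') →
        2 * (((P.L : ℝ) - 1) * P.L) * P.d * T₁ ^ 2 + 2 * δ' ^ 2 ≤ σ →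
      ∀ (κ' : ℝ), 0 ≤ κ' →
        4 / 3 * (P.d : ℝ) ^ 4 * (((P.L : ℝ) ^ k) ^ 2 * (K * (e * (1 + Real.log e⁻¹) ^ pexp) / ((P.L : ℝ) ^ k) ^ 2)) ^ 2 +
            B1.aSeq a P.L k ^ 2 * (c₀ * Real.exp (δ₀ / 2) * latticeConst P.d (δ₀ / 2)) *
              (((⌊(((P.L : ℝ) ^ k) - 1 + R₀) / sg⌋₊ : ℝ) + 3) ^ (d + 1) *
                  Real.exp (-(δ₀ * (((P.L : ℝ) ^ k)⁻¹ * (2 * R)))) +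
                Real.exp (-(δ₀ / 2 * (((P.L : ℝ) ^ k)⁻¹ * R₁)))) <
          c240 P (min (a / (9 * (P.d + 1))) (1 / 12)) κ' * (1 - σ) →
      ∀ (M : ℕ), 5 ≤ M → kR P.d 2 (gammaP P a k (K * (e * (1 + Real.log e⁻¹) ^ pexp) / ((P.L : ℝ) ^ k) ^ 2) c₀ δ₀ ((⌊(((P.L : ℝ) ^ k) - 1 + R₀) / sg⌋₊ + 3) ^ (d + 1)) R R₁ σ κ') (cP P a k c₀ δ₀ ((⌊(((P.L : ℝ) ^ k) - 1 + R₀) / sg⌋₊ + 3) ^ (d + 1)) κ') δ₀ < M →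
        thetaConst P.d 2 (gammaP P a k (K * (e * (1 + Real.log e⁻¹) ^ pexp) / ((P.L : ℝ) ^ k) ^ 2) c₀ δ₀ ((⌊(((P.L : ℝ) ^ k) - 1 + R₀) / sg⌋₊ + 3) ^ (d + 1)) R R₁ σ κ') (cP P a k c₀ δ₀ ((⌊(((P.L : ℝ) ^ k) - 1 + R₀) / sg⌋₊ + 3) ^ (d + 1)) κ') δ₀ < M →
        thetaW P.d 2 (gammaP P a k (K * (e * (1 + Real.log e⁻¹) ^ pexp) / ((P.L : ℝ) ^ k) ^ 2) c₀ δ₀ ((⌊(((P.L : ℝ) ^ k) - 1 + R₀) / sg⌋₊ + 3) ^ (d + 1)) R R₁ σ κ') (cP P a k c₀ δ₀ ((⌊(((P.L : ℝ) ^ k) - 1 + R₀) / sg⌋₊ + 3) ^ (d + 1)) κ') δ₀ M < 1 →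
      ∀ (s : ℕ), 0 < s →
        K0 P.d 2 (gammaP P a k (K * (e * (1 + Real.log e⁻¹) ^ pexp) / ((P.L : ℝ) ^ k) ^ 2) c₀ δ₀ ((⌊(((P.L : ℝ) ^ k) - 1 + R₀) / sg⌋₊ + 3) ^ (d + 1)) R R₁ σ κ') (cP P a k c₀ δ₀ ((⌊(((P.L : ℝ) ^ k) - 1 + R₀) / sg⌋₊ + 3) ^ (d + 1)) κ') δ₀ M ≤
          Real.exp (δ₀ / (128 * 9 ^ P.d) * s) →
        BIJ88Sect2Statements.Ineq246 (fun X : Finset (Cubes M s (chartSet Λ)) => X.card)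
          (fun (p : ↥Λ × Fin 2) (X : Finset (Cubes M s (chartSet Λ))) =>
            memX (fun (x : B4.Idx (chartSet Λ) 2) (l : ↥(B4Sect5CubeBounds.labels M (chartSet Λ))) =>
              B4Sect5CubeBounds.InBox M l.1 (x.1 : Fin P.d → ℤ)) (cubeOf M s) touch (idxEquiv Λ p) X)
          (fun X p q => cX (ldist (N := 2) M) ((s : ℝ) / 4) (cubeOf M s) touch (fun ω y₁ y₂ => latticeCw M (chartSet Λ) 2
              (reOp Λ (op240
            ((((B1.aSeq a P.L k / (B1RG242Torus.α P a k * (P.L : ℝ) ^ (k * P.d))) : ℝ) : ℂ) •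
              deltaLocT (B1RG242Torus.α P a k * (P.L : ℝ) ^ (k * P.d)) P.eps⁻¹ (actualBgU1 hd2 k e v) k (cubeFam hPd (P.L ^ k) c M0 sg W)
                (lamFam hPd (P.L ^ k) c M0 sg) (cutoff R₁ R₀ (B5Ineq137Torus.T P 0)))
            κ' (lineIter (actualBgU1 hd2 k e v) k))) ω y₁ y₂) X (idxEquiv Λ p) (idxEquiv Λ q))
          (δ₀ / (128 * 9 ^ P.d)) s := by
  obtain ⟨K, hK1, HK⟩ := smallPlaquette_actualBg (d := d + 1) (L := ℓ + 1) (by omega) pexp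
  obtain ⟨δ₀, c₀, hδ₀, hc₀, H⟩ := ineq246_printNorm_smallPlaquette_torus_cwt d ℓ hd1 hd3 hℓ hodd ha
  refine ⟨1 / (23 * ((d : ℝ) + 1) ^ 2 * K), δ₀, c₀, K, by positivity, hδ₀, hc₀, hK1, ?_⟩
  intro P hPd hPL hd2 k hk1 hkK hk' hbig e he he1 hsm v hv c M0 hM0 hfit0 hhalf sg W hsg R R₀ R₁ hRm hR₁ hR10 hW hgap Λ hΛ T₁ δ' σ hInt hTree hσ κ' hκ' hE M hM hMR hMθ hθW s hs hlarge
  have hk : k ≤ P.m + P.K := hkK.trans (Nat.le_add_left _ _)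
  have hdr : (P.d : ℝ) = (d : ℝ) + 1 := by rw [hPd]; push_cast; ring
  rw [← hdr] at hsm
  obtain ⟨hθ0, hplaq, -, -, -, -, hτ⟩ := HK P hPd hPL hd2 k hk1 hk e he he1 hsm v hv
  exact H P hPd hPL k hk1 hkK hk' hbig (actualBgU1 hd2 k e v) _ hθ0 hplaq hτ c M0 hM0 hfit0 hhalf sg W hsg R R₀ R₁ hRm hR₁ hR10 hW hgap Λ hΛ T₁ δ' σ
    hInt hTree hσ κ' hκ' hE M hM hMR hMθ hθW s hs hlarge

/-- **(2.47) (typed `Close`, torus distance) FOR THE PRINT-NORMALIZED `C^{(k)}_Λ(u_k)` AT THE ACTUAL BACKGROUND, `k`-UNIFORM CONSTANTS** — gen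
23's `close247_printNorm_smallPlaquette_torus_cwt` ∘ p34's passage. [cite: BalabanImbrieJaffe1985, (7.3.1) p.326] [cite: BalabanImbrieJaffe1988, (2.47) p.265] -/
theorem close247_printNorm_actualBg (d ℓ : ℕ) (hd1 : 1 ≤ d) (hd3 : d + 1 ≤ 3) (hℓ : 1 ≤ ℓ) (hodd : Odd (ℓ + 1)) {a : ℝ} (ha : 0 < a) (pexp : ℝ) :
    ∃ c₁ δ₀ c₀ K : ℝ, 0 < c₁ ∧ 0 < δ₀ ∧ 0 < c₀ ∧ 1 ≤ K ∧ ∀ (P : Params) (hPd : P.d = d + 1), P.L = ℓ + 1 →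
      ∀ (hd2 : 2 ≤ P.d) (k : ℕ), 1 ≤ k → k ≤ P.K → k + 1 ≤ P.m + P.K → 2 * (P.L ^ k - 1) + 4 < P.sitesPerDir 0 →
      ∀ (e : ℝ), 0 < e → e ≤ 1 → e * (1 + Real.log e⁻¹) ^ pexp ≤ c₁ →
      ∀ (v : U1Field P k), (∀ q : Balaban1983to89.Plaq P k, ‖((plaq v q : Circle) : ℂ) - 1‖ ≤ e * (1 + Real.log e⁻¹) ^ pexp) →
      ∀ (c M0 : Fin (d + 1) → ℕ), (∀ i, 1 ≤ M0 i) → (∀ i, c i * P.L ^ k + P.L ^ k * M0 i ≤ P.sitesPerDir 0) →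
        (∀ i, 2 * (P.L ^ k * M0 i) ≤ P.sitesPerDir 0) →
      ∀ (sg W : ℕ), 1 ≤ sg → ∀ (R R₀ R₁ : ℝ), 10 * (P.L : ℝ) ^ k < R → 0 ≤ R₁ → R₁ < R₀ →
        2 * (sg : ℝ) / 3 + R₀ / 2 + R ≤ W → (∀ i, ((P.L ^ k * M0 i : ℕ) : ℝ) + R ≤ P.sitesPerDir 0) →
      ∀ (Λ : Finset (Balaban1983to89.Site P (0 + k))),
        (∀ y₁ ∈ Λ, ∀ μ, (c (Fin.cast hPd μ) : ℝ) * P.L ^ k + (R₀ + R) ≤ (P.L : ℝ) ^ k * (y₁ μ).val ∧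
          (P.L : ℝ) ^ k * (y₁ μ).val + P.L ^ k + (R₀ + R) ≤ (c (Fin.cast hPd μ) : ℝ) * P.L ^ k + (P.L : ℝ) ^ k * M0 (Fin.cast hPd μ)) →
      ∀ (T₁ δ' σ : ℝ),
        (∀ b : PBond P (0 + k), blkIter 1 b.src = blkIter 1 b.tgt → ‖toC (lineIter (actualBgU1 hd2 k e v) k b) - 1‖ ≤ T₁) →
        (∀ y : Balaban1983to89.Site P (0 + k), ‖holCK (lineIter (actualBgU1 hd2 k e v) k) 1 y - 1‖ ≤ δ') →
        2 * (((P.L : ℝ) - 1) * P.L) * P.d * T₁ ^ 2 + 2 * δ' ^ 2 ≤ σ →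
      ∀ (κ' : ℝ), 0 ≤ κ' →
        4 / 3 * (P.d : ℝ) ^ 4 * (((P.L : ℝ) ^ k) ^ 2 * (K * (e * (1 + Real.log e⁻¹) ^ pexp) / ((P.L : ℝ) ^ k) ^ 2)) ^ 2 +
            B1.aSeq a P.L k ^ 2 * (c₀ * Real.exp (δ₀ / 2) * latticeConst P.d (δ₀ / 2)) *
              (((⌊(((P.L : ℝ) ^ k) - 1 + R₀) / sg⌋₊ : ℝ) + 3) ^ (d + 1) *
                  Real.exp (-(δ₀ * (((P.L : ℝ) ^ k)⁻¹ * (2 * R)))) +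
                Real.exp (-(δ₀ / 2 * (((P.L : ℝ) ^ k)⁻¹ * R₁)))) <
          c240 P (min (a / (9 * (P.d + 1))) (1 / 12)) κ' * (1 - σ) →
      ∀ (M : ℕ), 5 ≤ M → kR P.d 2 (gammaP P a k (K * (e * (1 + Real.log e⁻¹) ^ pexp) / ((P.L : ℝ) ^ k) ^ 2) c₀ δ₀ ((⌊(((P.L : ℝ) ^ k) - 1 + R₀) / sg⌋₊ + 3) ^ (d + 1)) R R₁ σ κ') (cP P a k c₀ δ₀ ((⌊(((P.L : ℝ) ^ k) - 1 + R₀) / sg⌋₊ + 3) ^ (d + 1)) κ') δ₀ < M →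
        thetaConst P.d 2 (gammaP P a k (K * (e * (1 + Real.log e⁻¹) ^ pexp) / ((P.L : ℝ) ^ k) ^ 2) c₀ δ₀ ((⌊(((P.L : ℝ) ^ k) - 1 + R₀) / sg⌋₊ + 3) ^ (d + 1)) R R₁ σ κ') (cP P a k c₀ δ₀ ((⌊(((P.L : ℝ) ^ k) - 1 + R₀) / sg⌋₊ + 3) ^ (d + 1)) κ') δ₀ < M →
        thetaW P.d 2 (gammaP P a k (K * (e * (1 + Real.log e⁻¹) ^ pexp) / ((P.L : ℝ) ^ k) ^ 2) c₀ δ₀ ((⌊(((P.L : ℝ) ^ k) - 1 + R₀) / sg⌋₊ + 3) ^ (d + 1)) R R₁ σ κ') (cP P a k c₀ δ₀ ((⌊(((P.L : ℝ) ^ k) - 1 + R₀) / sg⌋₊ + 3) ^ (d + 1)) κ') δ₀ M < 1 →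
      ∀ (ρ : ℝ),
        BIJ88Sect2Statements.Close (fun p q : ↥Λ × Fin 2 => B5Ineq137Torus.T P (0 + k) p.1.1 q.1.1 / M)
          (fun p q => cLoc (ldist (N := 2) M) ρ (fun ω y₁ y₂ => latticeCw M (chartSet Λ) 2
              (reOp Λ (op240
            ((((B1.aSeq a P.L k / (B1RG242Torus.α P a k * (P.L : ℝ) ^ (k * P.d))) : ℝ) : ℂ) •
              deltaLocT (B1RG242Torus.α P a k * (P.L : ℝ) ^ (k * P.d)) P.eps⁻¹ (actualBgU1 hd2 k e v) k (cubeFam hPd (P.L ^ k) c M0 sg W)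
                (lamFam hPd (P.L ^ k) c M0 sg) (cutoff R₁ R₀ (B5Ineq137Torus.T P 0)))
            κ' (lineIter (actualBgU1 hd2 k e v) k))) ω y₁ y₂) (idxEquiv Λ p) (idxEquiv Λ q))
          (fun p q => realify (compress Λ (op240
            ((((B1.aSeq a P.L k / (B1RG242Torus.α P a k * (P.L : ℝ) ^ (k * P.d))) : ℝ) : ℂ) •
              deltaLocT (B1RG242Torus.α P a k * (P.L : ℝ) ^ (k * P.d)) P.eps⁻¹ (actualBgU1 hd2 k e v) k (cubeFam hPd (P.L ^ k) c M0 sg W)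
                (lamFam hPd (P.L ^ k) c M0 sg) (cutoff R₁ R₀ (B5Ineq137Torus.T P 0)))
            κ' (lineIter (actualBgU1 hd2 k e v) k)))⁻¹ p q)
          (2 ^ P.d * (gammaP P a k (K * (e * (1 + Real.log e⁻¹) ^ pexp) / ((P.L : ℝ) ^ k) ^ 2) c₀ δ₀ ((⌊(((P.L : ℝ) ^ k) - 1 + R₀) / sg⌋₊ + 3) ^ (d + 1)) R R₁ σ κ')⁻¹ *
              (1 - thetaW P.d 2 (gammaP P a k (K * (e * (1 + Real.log e⁻¹) ^ pexp) / ((P.L : ℝ) ^ k) ^ 2) c₀ δ₀ ((⌊(((P.L : ℝ) ^ k) - 1 + R₀) / sg⌋₊ + 3) ^ (d + 1)) R R₁ σ κ')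
                (cP P a k c₀ δ₀ ((⌊(((P.L : ℝ) ^ k) - 1 + R₀) / sg⌋₊ + 3) ^ (d + 1)) κ') δ₀ M)⁻¹ *
            Real.exp (-(δ₀ / 16 * (ρ - 3)))) (δ₀ / 16) := by
  obtain ⟨K, hK1, HK⟩ := smallPlaquette_actualBg (d := d + 1) (L := ℓ + 1) (by omega) pexp
  obtain ⟨δ₀, c₀, hδ₀, hc₀, H⟩ := close247_printNorm_smallPlaquette_torus_cwt d ℓ hd1 hd3 hℓ hodd ha
  refine ⟨1 / (23 * ((d : ℝ) + 1) ^ 2 * K), δ₀, c₀, K, by positivity, hδ₀, hc₀, hK1, ?_⟩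
  intro P hPd hPL hd2 k hk1 hkK hk' hbig e he he1 hsm v hv c M0 hM0 hfit0 hhalf sg W hsg R R₀ R₁ hRm hR₁ hR10 hW hgap Λ hΛ T₁ δ' σ hInt hTree hσ κ' hκ' hE M hM hMR hMθ hθW ρ
  have hk : k ≤ P.m + P.K := hkK.trans (Nat.le_add_left _ _)
  have hdr : (P.d : ℝ) = (d : ℝ) + 1 := by rw [hPd]; push_cast; ring
  rw [← hdr] at hsm
  obtain ⟨hθ0, hplaq, -, -, -, -, hτ⟩ := HK P hPd hPL hd2 k hk1 hk e he he1 hsm v hv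
  exact H P hPd hPL k hk1 hkK hk' hbig (actualBgU1 hd2 k e v) _ hθ0 hplaq hτ c M0 hM0 hfit0 hhalf sg W hsg R R₀ R₁ hRm hR₁ hR10 hW hgap Λ hΛ T₁ δ' σ
    hInt hTree hσ κ' hκ' hE M hM hMR hMθ hθW ρ

end

end Literature.MathematicalPhysics.QuantumFieldTheory.BalabanImbrieJaffe1984to88.BIJ88Eq242HiggsCovariancePrintNormActualBackground
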